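import Literature.AnabelianGeometry.SemiGraphs.TemperedPiLevelKernelVertGen
import Literature.AnabelianGeometry.SemiGraphs.CharacteristicOpenCore
import HarnessLib

/-!
# [SemiAnbd] Thm 5.4 producer T54-B, E1 JUNCTION: the Φ-stability binders `hKst`/`hLst` of the capstone
# at the arithmetic group `π₁^temp(𝒢) ⋊^out Π_A`

Mochizuki, *Semi-graphs of anabelioids*, Publ. RIMS **42** (2006), §5 Def 5.1 (i) p. 62, Prop 5.2 (i)/(iv)
pp. 63–64, proof of Thm 5.4 p. 66 [cite: MochizukiSemiAnbd2006, Thm 5.4 (i), p. 66]; Dixon–du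
Sautoy–Mann–Segal, *Analytic pro-p groups*, Prop. 1.6 (characteristic open subgroups) [cite: DixonEtAl1999, Prop 1.6].

PROOF-ONLY file (no definitions; seat abc-iut-L3-t9, E1 junction of the cell's T54 binder board; cell row
T54-B = `plan/GAP-LEDGER.md` G-w4d053-1).  The capstone `arithMaximalCompactStatementI_outerAction_piPresentation`
(abc-iut-w4-d029) carries, at a Galois tower `D` (abc-iut-L3-t9's `GaloisLevelData`) with presentation
`P := D.piPresentation T R` (abc-iut-L3-d4), two Φ-stability binders for the automorphism-component action
`Φ := (Aut-component) : π₁^temp(𝒢) ⋊^out_ρ Π_A → Aut(π₁^temp 𝒢)`: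

  `hKst : ∀ n e x, x ∈ ker ρ_n → Φ e x ∈ ker ρ_n`   (tree levels),
  `hLst : ∀ n e x, x ∈ ker π_n → Φ e x ∈ ker π_n`   (finite levels).

Here:

* `continuous_outerAutComponent` — every `Φ e` is a bi-continuous automorphism (it IS an element of
  `Aut_top`), so
* **`hKst_of_hLst_outerAction`** — `hKst` FOLLOWS from `hLst`, for every outer action `ρ` and every
  arithmetically compatible presentation: abc-iut-w4-d071's binder-free `hK_of_hN` (`TemperedPiLevelKernelVertGen`,
  E1c: `ker ρ_n = vertGen (ker π_n)`) at this `Φ`.  The capstone keeps ONE stability binder, `hLst`;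
* **`hLst_of_forall_map_eq`** — `hLst` holds as soon as every finite level `ker π_n` is fixed by EVERY
  bi-continuous automorphism of `π₁^temp(𝒢)` (characteristic levels), and
* **`hLst_of_ker_piLevelAut_eq_charOpenCore`** — in particular when the finite levels are abc-iut-w4-d053's
  CHARACTERISTIC OPEN CORES `charOpenCore π₁^temp (d n)` (`CharacteristicOpenCore.lean`): the exact shape
  the E1b instantiation / the characteristic tower `GaloisLevelData.ofGaloisSeq` (abc-iut-L3-t9, p428866)
  must supply; `hKst_and_hLst_of_ker_piLevelAut_eq_charOpenCore` packages both binders.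

HONEST FRAME: at the FIXED enumeration `𝒢.galoisLevelData h36` the finite levels are NOT characteristic in
general, so `hLst` there is not a theorem; the junction's remaining half is the change of tower to one with
characteristic finite levels (the chart of an arbitrary tower + the comparison of tempered groups), filed
separately.  Nothing here refers to the IUT corpus; no side is taken on [IUTchIII] Cor 3.12; typed ≠ proved.
-/

namespace Literature.AnabelianGeometry.SemiGraphs

namespace ProfiniteSemiGraph

namespace GaloisLevelData

open CategoryTheory Topology
open Literature.AnabelianGeometry.EtaleTheta

universe u w

variable {𝒢 : ProfiniteSemiGraph.{u}} (D : GaloisLevelData 𝒢) (h𝒢 : 𝒢.IsCountable)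
  (hconn : ∀ (n : ℕ) (p q : (D.S n).Point), (D.S n).SameComponent p q)
  (T : ∀ w : 𝒢.graph.Vertex, D.PointSeq h𝒢 w) (R : SemiGraph.RefBranches 𝒢.graph)
  {PA : Type w} [Group PA] (ρ : PA →* TopOut (D.temperedPi h𝒢))

/-- The automorphism component of an element of `π₁^temp(𝒢) ⋊^out_ρ Π_A` is (bi-)continuous — it is an
element of `Aut_top(π₁^temp 𝒢)`. [cite: MochizukiSemiAnbd2006, §0 p.5] -/
theorem continuous_outerAutComponent (e : outerSemidirectProduct ρ) :
    Continuous ((((contMulAut (D.temperedPi h𝒢)).subtype.comp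
      (MonoidHom.fst (contMulAut (D.temperedPi h𝒢)) PA)).comp (outerSemidirectProduct ρ).subtype) e) :=
  e.1.1.2.1

/-- **`hKst ⟸ hLst` at every tower, for every outer action**: the Φ-stability of the tree levels `ker ρ_n`
under `π₁^temp(𝒢) ⋊^out_ρ Π_A` follows from that of the finite levels `ker π_n` (abc-iut-w4-d071's
`hK_of_hN` — E1c, binder-free — at the automorphism-component action, whose continuity is automatic).
[cite: MochizukiSemiAnbd2006, Thm 5.4 (i), p. 66] -/
theorem hKst_of_hLst_outerAction {baseAct : PA →* Aut 𝒢.graph}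
    (hP : (D.piPresentation h𝒢 T R).IsArithCompatible
      (((contMulAut (D.temperedPi h𝒢)).subtype.comp (MonoidHom.fst (contMulAut (D.temperedPi h𝒢)) PA)).comp
        (outerSemidirectProduct ρ).subtype) (baseAct.comp (outerSemidirectProductSnd ρ)))
    (hLst : ∀ (n : ℕ) (e : outerSemidirectProduct ρ) (x : D.temperedPi h𝒢),
      x ∈ (D.piLevelAut h𝒢 hconn n).ker →
        (((contMulAut (D.temperedPi h𝒢)).subtype.comp (MonoidHom.fst (contMulAut (D.temperedPi h𝒢)) PA)).comp
          (outerSemidirectProduct ρ).subtype) e x ∈ (D.piLevelAut h𝒢 hconn n).ker)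
    (n : ℕ) (e : outerSemidirectProduct ρ) (x : D.temperedPi h𝒢) (hx : x ∈ (D.projAut h𝒢 n).ker) :
    (((contMulAut (D.temperedPi h𝒢)).subtype.comp (MonoidHom.fst (contMulAut (D.temperedPi h𝒢)) PA)).comp
      (outerSemidirectProduct ρ).subtype) e x ∈ (D.projAut h𝒢 n).ker :=
  D.hK_of_hN h𝒢 hconn T R hP (D.continuous_outerAutComponent h𝒢 ρ) hLst n e x hx

/-- **`hLst` for CHARACTERISTIC finite levels**: if every finite level `ker π_n` is fixed by every
bi-continuous automorphism of `π₁^temp(𝒢)`, then the finite levels are stable under `π₁^temp(𝒢) ⋊^out_ρ Π_A`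
for every `ρ`. [cite: DixonEtAl1999, Prop 1.6] -/
theorem hLst_of_forall_map_eq
    (hchar : ∀ (n : ℕ) (φ : MulAut (D.temperedPi h𝒢)), Continuous φ → Continuous φ.symm →
      ((D.piLevelAut h𝒢 hconn n).ker).map φ.toMonoidHom = (D.piLevelAut h𝒢 hconn n).ker)
    (n : ℕ) (e : outerSemidirectProduct ρ) (x : D.temperedPi h𝒢) (hx : x ∈ (D.piLevelAut h𝒢 hconn n).ker) :
    (((contMulAut (D.temperedPi h𝒢)).subtype.comp (MonoidHom.fst (contMulAut (D.temperedPi h𝒢)) PA)).comp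
      (outerSemidirectProduct ρ).subtype) e x ∈ (D.piLevelAut h𝒢 hconn n).ker := by
  have h := hchar n (e.1.1 : MulAut (D.temperedPi h𝒢)) e.1.1.2.1 e.1.1.2.2
  rw [← h]
  exact ⟨x, hx, rfl⟩

/-- **`hLst` when the finite levels ARE characteristic open cores**: if `ker π_n = charOpenCore π₁^temp (d n)`
for some level assignment `d`, the finite levels are stable under `π₁^temp(𝒢) ⋊^out_ρ Π_A` for every `ρ`
(abc-iut-w4-d053's `map_charOpenCore_eq`). [cite: DixonEtAl1999, Prop 1.6] -/
theorem hLst_of_ker_piLevelAut_eq_charOpenCore (d : ℕ → ℕ)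
    (hker : ∀ n, (D.piLevelAut h𝒢 hconn n).ker = charOpenCore (D.temperedPi h𝒢) (d n))
    (n : ℕ) (e : outerSemidirectProduct ρ) (x : D.temperedPi h𝒢) (hx : x ∈ (D.piLevelAut h𝒢 hconn n).ker) :
    (((contMulAut (D.temperedPi h𝒢)).subtype.comp (MonoidHom.fst (contMulAut (D.temperedPi h𝒢)) PA)).comp
      (outerSemidirectProduct ρ).subtype) e x ∈ (D.piLevelAut h𝒢 hconn n).ker := by
  refine D.hLst_of_forall_map_eq h𝒢 hconn ρ (fun m φ hφ hφ' => ?_) n e x hx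
  rw [hker m]
  exact map_charOpenCore_eq φ hφ hφ'

/-- **Both capstone binders from characteristic finite levels**: if `ker π_n = charOpenCore π₁^temp (d n)`,
then `hLst` AND `hKst` hold at the tower for every outer action `ρ` and every arithmetically compatible
presentation. [cite: MochizukiSemiAnbd2006, Thm 5.4 (i), p. 66] -/
theorem hKst_and_hLst_of_ker_piLevelAut_eq_charOpenCore {baseAct : PA →* Aut 𝒢.graph}
    (hP : (D.piPresentation h𝒢 T R).IsArithCompatible
      (((contMulAut (D.temperedPi h𝒢)).subtype.comp (MonoidHom.fst (contMulAut (D.temperedPi h𝒢)) PA)).comp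
        (outerSemidirectProduct ρ).subtype) (baseAct.comp (outerSemidirectProductSnd ρ)))
    (d : ℕ → ℕ) (hker : ∀ n, (D.piLevelAut h𝒢 hconn n).ker = charOpenCore (D.temperedPi h𝒢) (d n)) :
    (∀ (n : ℕ) (e : outerSemidirectProduct ρ) (x : D.temperedPi h𝒢), x ∈ (D.projAut h𝒢 n).ker →
      (((contMulAut (D.temperedPi h𝒢)).subtype.comp (MonoidHom.fst (contMulAut (D.temperedPi h𝒢)) PA)).comp
        (outerSemidirectProduct ρ).subtype) e x ∈ (D.projAut h𝒢 n).ker) ∧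
    (∀ (n : ℕ) (e : outerSemidirectProduct ρ) (x : D.temperedPi h𝒢), x ∈ (D.piLevelAut h𝒢 hconn n).ker →
      (((contMulAut (D.temperedPi h𝒢)).subtype.comp (MonoidHom.fst (contMulAut (D.temperedPi h𝒢)) PA)).comp
        (outerSemidirectProduct ρ).subtype) e x ∈ (D.piLevelAut h𝒢 hconn n).ker) :=
  ⟨D.hKst_of_hLst_outerAction h𝒢 hconn T R ρ hP
      (D.hLst_of_ker_piLevelAut_eq_charOpenCore h𝒢 hconn ρ d hker),
    D.hLst_of_ker_piLevelAut_eq_charOpenCore h𝒢 hconn ρ d hker⟩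

end GaloisLevelData

end ProfiniteSemiGraph

end Literature.AnabelianGeometry.SemiGraphs
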